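import Summits.Ventures.CertifiedManyBodySolver.Observables.BraggWeightPeriodicPattern
import HarnessLib

/-!
# The `1/|B|` law of the box pair-ODLRO ceiling is SHARP: finite-range pair data cannot see below `P(0)/M^d`

HONEST FRAMING: first certified bounds on pairing observables; not a superconductivity verdict; every
number certified (two lineages + referee) or labelled float. Crew hubbard-obs (D-0042), seat hubbard-obs-p1
(`prover-hubbard-obs-p1-g2-0`), lead ruling (ao)/d96 («the box/kernel ODLRO ceiling is a FOOTPRINT-limited
instrument»). Pure harmonic analysis on the discrete torus; zero compute; no state, no certificate, no named
fact, no `sorry`. Three auxiliary definitions (`deltaPattern`, `dimerSite`, `dimerPattern`) — explicit test patterns, not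
objects of the theory.

The box ceiling (`PairODLROCeilingTL.sq_card_mul_braggWeight_zero_le`) reads `m² ≤ F_B/|B|²` from the pair
cells `P(r)`, `r ∈ B − B`; kernels (`PairKernelCeilingTL`) do not change the `1/|B|` rate. This file proves the
rate is OPTIMAL for every method whose input is the pair two-point function on a finite box and whose only other
ingredient is positivity (Bochner): for every period `M ≥ 1` and dimension `d ≥ 1` there are two lattice
functions `C₁, C₂ : ℤᵈ → ℂ`, each the autocorrelation of a periodic pattern (hence positive definite, represented
by an explicit atomic spectral measure), which

* AGREE on the whole sup-norm box `‖r‖∞ < M`: `C₁ r = C₂ r = 0` for `0 < ‖r‖∞ < M` and `C₁ 0 = C₂ 0 = M^{-d}`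
  (the IDEAL «no pair correlation at any range `< M`» data);
* have ODLRO density (Bragg weight of ANY representing measure at `Q = 0`) **`C₁(0)/M^d`** (`deltaPattern`: one
  site per period cell of `(ℤ/Mℤ)ᵈ` — a pair-density wave) and **`0`** (`dimerPattern`: the signed two-site pattern
  on `(ℤ/2Mℤ)ᵈ`, zero mean), respectively

(`braggWeight_zero_of_represents_deltaPattern`, `braggWeight_zero_of_represents_dimerPattern`,
`autocorr_deltaPattern_toTorus_eq_zero`, `autocorr_dimerPattern_toTorus_eq_zero`, …). Consequently
(`exists_noODLRO_witness_of_boxLocal_ceiling`): **every ceiling functional `Φ` that is SOUND (`braggWeight μ ![0] ≤ Φ C`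
for every finite measure `μ` representing `C`) and RANGE-`M` LOCAL (depends only on `C` restricted to `‖r‖∞ < M`)
satisfies `Φ C ≥ C(0)/M^d` on a lattice function `C` whose true ODLRO density is `0`.** The box functional with
`B = {0,…,M−1}ᵈ` attains exactly `C(0)/M^d` on these data, so the `1/|B|` bias of d96 is not an artefact of the
Fejér kernel but the information-theoretic limit of range-`M` pair data: with the local pair density
`P_d(0,0) ≈ 1.37` [float, every host] a ceiling `≤ 1/200` (the `StripePointCeiling` threshold of route
AbsenceCertificate) needs range `M ≥ 17` data EVEN FOR A STATE WITH IDENTICALLY ZERO PAIR CORRELATIONS AT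
EVERY RANGE `0 < ‖r‖∞ < 17`; anything sharper must come from an input that is uniform in `r` (decay / clustering),
not from more cells.

barrier-style summary (for a future `Literature/Barriers/HubbardSuperconductivity` entry; this file is its proof):
technique_class: ODLRO (pair Bragg weight at `Q = 0`) CEILINGS from finitely many translation-invariant pair
two-point cells + Bochner positivity (box / Fejér / PSD-kernel functionals, any SDP that sees pair words only up to
range `M`). blocks: «certify `m_d² ≤ c` with `c < P_d(0,0)/M^d` from range-`< M` pair data alone». because: the two
witnesses below are indistinguishable on the box and have ODLRO densities `P(0)/M^d` and `0`. evasions: larger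
range (rate exactly `M^{-d}`); inputs uniform in `r` (certified decay at ALL large `r`, clustering theorems);
constraints that are not functions of the pair two-point data (none known to bite, TARGET §3 (K)).
status: PROVED here.

References: Katznelson, *An Introduction to Harmonic Analysis* (2004) I.7 (a measure is determined by ALL its
Fourier–Stieltjes coefficients; Herglotz); Grafakos, *Classical Fourier Analysis* (2008) Prop. 3.1.7 (Fejér);
Yang, Rev. Mod. Phys. 34 (1962) 694 §3 (ODLRO as the macroscopic eigenvalue / `Q = 0` weight).
-/

noncomputable section

namespace Summit.Ventures.CertifiedManyBodySolver.Observables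

open MeasureTheory Complex Filter Topology Finset ZMod
open Literature.Probability.LatticeModels
open scoped Real BigOperators NNReal ENNReal ComplexConjugate

variable {d : ℕ}

/-! ### §0. Two small facts: `dualVec 0 = 0`; box vectors reduce to `0` only if they are `0` -/

/-- The origin of the dual grid is the wavevector `0`. -/
theorem dualVec_zero (L : ℕ) : dualVec (0 : TorusSite d L) = (0 : Fin d → ℝ) := by
  funext i
  simp [dualVec, ZMod.valMinAbs_zero]

/-- An integer of absolute value `< L` divisible by `L` is `0`. [folklore] -/
private theorem int_eq_zero_of_dvd_of_abs_lt {L : ℕ} {a : ℤ} (h : (L : ℤ) ∣ a) (ha : |a| < L) : a = 0 := by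
  refine Int.eq_zero_of_dvd_of_natAbs_lt_natAbs h ?_
  have : (a.natAbs : ℤ) < (L : ℤ) := by rw [Int.natCast_natAbs]; exact ha
  exact_mod_cast this

/-- A lattice vector in the open sup-norm box `‖r‖∞ < L` that reduces to `0` modulo `L` is `0`. -/
theorem eq_zero_of_toTorus_eq_zero {L : ℕ} {r : Fin d → ℤ} (hr : ∀ i, |r i| < L)
    (h0 : toTorus L r = 0) : r = 0 := by
  funext i
  have hi : ((r i : ℤ) : ZMod L) = 0 := by
    have := congrFun h0 i
    simpa [toTorus] using this
  rw [ZMod.intCast_zmod_eq_zero_iff_dvd] at hi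
  exact int_eq_zero_of_dvd_of_abs_lt hi (hr i)

/-! ### §1. Witness WITH off-diagonal long-range order: the delta pattern on `(ℤ/Mℤ)ᵈ` -/

section Delta

variable (M : ℕ) [NeZero M]

/-- The one-site-per-cell pattern on the torus `(ℤ/Mℤ)ᵈ`: `f(0) = 1`, `f(x) = 0` otherwise (a period-`M`
pair-density wave when read as a pair amplitude). [folklore] -/
def deltaPattern : TorusSite d M → ℂ := fun x => if x = 0 then 1 else 0

/-- Its autocorrelation vanishes off the period lattice: `C(z) = 0` for `z ≠ 0` in the torus. -/
theorem autocorr_deltaPattern_of_ne_zero {z : TorusSite d M} (hz : z ≠ 0) :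
    autocorr (deltaPattern (d := d) M) z = 0 := by
  unfold autocorr
  rw [Finset.sum_eq_single (0 : TorusSite d M)]
  · simp [deltaPattern, hz]
  · intro x _ hx
    simp [deltaPattern, hx]
  · intro h; exact absurd (Finset.mem_univ _) h

/-- On the lattice: `C₁(r) = 0` for every `r ≠ 0` with `‖r‖∞ < M`. -/
theorem autocorr_deltaPattern_toTorus_eq_zero {r : Fin d → ℤ} (hr : ∀ i, |r i| < M) (hr0 : r ≠ 0) :
    autocorr (deltaPattern (d := d) M) (toTorus M r) = 0 :=
  autocorr_deltaPattern_of_ne_zero M fun h => hr0 (eq_zero_of_toTorus_eq_zero hr h)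

/-- At the origin: `C₁(0) = M^{-d}`. -/
theorem autocorr_deltaPattern_zero : autocorr (deltaPattern (d := d) M) 0 = ((M : ℂ) ^ d)⁻¹ := by
  rw [autocorr_zero, Finset.sum_eq_single (0 : TorusSite d M)]
  · simp [deltaPattern]
  · intro x _ hx
    simp [deltaPattern, hx]
  · intro h; exact absurd (Finset.mem_univ _) h

/-- Its mean: `f̂(0) = M^{-d}`. -/
theorem fourierCoeff_deltaPattern_zero : fourierCoeff (deltaPattern (d := d) M) 0 = ((M : ℂ) ^ d)⁻¹ := by
  rw [fourierCoeff_zero, Finset.sum_eq_single (0 : TorusSite d M)]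
  · simp [deltaPattern]
  · intro x _ hx
    simp [deltaPattern, hx]
  · intro h; exact absurd (Finset.mem_univ _) h

/-- **ODLRO of the delta pattern.** For EVERY finite measure `μ` representing `r ↦ C₁(r)` (Herglotz form), the
Bragg weight at `Q = 0` is `M^{-2d} = C₁(0) · M^{-d}` — a fraction `1/M^d = 1/|B|` of the local value.
[cite: Yang1962, §3] -/
theorem braggWeight_zero_of_represents_deltaPattern (μ : Measure (EuclideanSpace ℝ (Fin d))) [IsFiniteMeasure μ]
    (hμ : ∀ r : Fin d → ℤ, ∫ ξ, exp ((∑ i, (r i : ℝ) * ξ i : ℝ) * I) ∂μ =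
      autocorr (deltaPattern (d := d) M) (toTorus M r)) :
    braggWeight μ ![(0 : Fin d → ℝ)] = (((M : ℝ) ^ d)⁻¹) ^ 2 := by
  rw [← dualVec_zero M, braggWeight_of_represents_autocorr _ μ hμ 0, fourierCoeff_deltaPattern_zero]
  rw [norm_inv, norm_pow, Complex.norm_natCast]

end Delta

/-! ### §2. Witness WITHOUT off-diagonal long-range order, same box data: the signed dimer on `(ℤ/2Mℤ)ᵈ` -/

section Dimer

variable (M : ℕ) [NeZero M] (i₀ : Fin d)

/-- The antipodal site `v = M e_{i₀}` of the torus `(ℤ/2Mℤ)ᵈ`. -/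
def dimerSite : TorusSite d (2 * M) := fun i => if i = i₀ then ((M : ℕ) : ZMod (2 * M)) else 0

/-- `M ≠ 0` in `ℤ/2Mℤ`. -/
theorem natCast_ne_zero_zmod_two_mul : ((M : ℕ) : ZMod (2 * M)) ≠ 0 := by
  intro h
  rw [ZMod.natCast_eq_zero_iff] at h
  have hM : 0 < M := Nat.pos_of_ne_zero (NeZero.ne M)
  have := Nat.le_of_dvd hM h
  omega

/-- `v ≠ 0`. -/
theorem dimerSite_ne_zero : dimerSite (d := d) M i₀ ≠ 0 := by
  intro h
  have := congrFun h i₀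
  simp [dimerSite] at this
  exact natCast_ne_zero_zmod_two_mul M this

/-- The signed two-site pattern on `(ℤ/2Mℤ)ᵈ`, scaled so that `C₂(0) = M^{-d}`: `f(0) = c`, `f(v) = −c`, `0`
otherwise, with `c = √(2^{d-1})` (real). Zero mean, hence NO Bragg weight at the origin. [folklore] -/
def dimerPattern : TorusSite d (2 * M) → ℂ := fun x =>
  if x = 0 then ((Real.sqrt (2 ^ (d - 1)) : ℝ) : ℂ)
  else if x = dimerSite M i₀ then -(((Real.sqrt (2 ^ (d - 1)) : ℝ) : ℂ)) else 0

omit [NeZero M] in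
/-- Values of the dimer pattern off its two sites. -/
theorem dimerPattern_of_ne {x : TorusSite d (2 * M)} (h0 : x ≠ 0) (hv : x ≠ dimerSite M i₀) :
    dimerPattern (d := d) M i₀ x = 0 := by
  simp [dimerPattern, h0, hv]

/-- The dimer pattern has zero mean: `f̂(0) = 0`. -/
theorem fourierCoeff_dimerPattern_zero : fourierCoeff (dimerPattern (d := d) M i₀) 0 = 0 := by
  rw [fourierCoeff_zero, Finset.sum_eq_add (0 : TorusSite d (2 * M)) (dimerSite M i₀) (dimerSite_ne_zero M i₀).symm]
  · simp [dimerPattern, (dimerSite_ne_zero M i₀)]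
  · intro x _ hx
    exact dimerPattern_of_ne M i₀ hx.1 hx.2
  · intro h; exact absurd (Finset.mem_univ _) h
  · intro h; exact absurd (Finset.mem_univ _) h

/-- Its autocorrelation vanishes at every `z ∉ {0, v, −v}`. -/
theorem autocorr_dimerPattern_of_ne {z : TorusSite d (2 * M)} (hz0 : z ≠ 0) (hzv : z ≠ dimerSite M i₀)
    (hzv' : z ≠ -dimerSite M i₀) : autocorr (dimerPattern (d := d) M i₀) z = 0 := by
  unfold autocorr
  rw [Finset.sum_eq_add (0 : TorusSite d (2 * M)) (dimerSite M i₀) (dimerSite_ne_zero M i₀).symm]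
  · have h1 : dimerPattern (d := d) M i₀ (0 + z) = 0 := by
      rw [zero_add]; exact dimerPattern_of_ne M i₀ hz0 hzv
    have h2 : dimerPattern (d := d) M i₀ (dimerSite M i₀ + z) = 0 := by
      refine dimerPattern_of_ne M i₀ ?_ ?_
      · intro h; exact hzv' (eq_neg_of_add_eq_zero_right h)
      · intro h; exact hz0 (by simpa using h)
    rw [h1, h2]; simp
  · intro x _ hx
    rw [dimerPattern_of_ne M i₀ hx.1 hx.2]; simp
  · intro h; exact absurd (Finset.mem_univ _) h
  · intro h; exact absurd (Finset.mem_univ _) h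

/-- A box vector `‖r‖∞ < M` never reduces to `±v = ±M e_{i₀}` modulo `2M`, and reduces to `0` only if `r = 0`. -/
theorem toTorus_twoMul_ne_dimerSite {r : Fin d → ℤ} (hr : ∀ i, |r i| < M) :
    toTorus (2 * M) r ≠ dimerSite M i₀ ∧ toTorus (2 * M) r ≠ -dimerSite M i₀ := by
  have hM : (0 : ℤ) < M := by exact_mod_cast Nat.pos_of_ne_zero (NeZero.ne M)
  have hri := hr i₀
  have key : ∀ s : ℤ, (s = (M : ℤ) ∨ s = -(M : ℤ)) → ((r i₀ : ℤ) : ZMod (2 * M)) ≠ ((s : ℤ) : ZMod (2 * M)) := by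
    intro s hs h
    rw [ZMod.intCast_eq_intCast_iff_dvd_sub] at h
    -- `2M ∣ s - r i₀` with `|s - r i₀| < 2M` and `s - r i₀ ≠ 0`
    have hlt : |s - r i₀| < ((2 * M : ℕ) : ℤ) := by
      push_cast
      rcases hs with rfl | rfl <;> [rw [abs_lt]; rw [abs_lt]] <;> constructor <;>
        linarith [(abs_lt.1 hri).1, (abs_lt.1 hri).2]
    have hzero := int_eq_zero_of_dvd_of_abs_lt h hlt
    rcases hs with rfl | rfl <;> linarith [(abs_lt.1 hri).1, (abs_lt.1 hri).2]
  constructor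
  · intro h
    have := congrFun h i₀
    simp only [toTorus, dimerSite] at this
    exact key M (Or.inl rfl) (by rw [this]; push_cast; rfl)
  · intro h
    have := congrFun h i₀
    simp only [toTorus, dimerSite, Pi.neg_apply] at this
    exact key (-(M : ℤ)) (Or.inr rfl) (by rw [this]; push_cast; rfl)

/-- On the lattice: `C₂(r) = 0` for every `r ≠ 0` with `‖r‖∞ < M` — the SAME box data as the delta pattern. -/
theorem autocorr_dimerPattern_toTorus_eq_zero {r : Fin d → ℤ} (hr : ∀ i, |r i| < M) (hr0 : r ≠ 0) :
    autocorr (dimerPattern (d := d) M i₀) (toTorus (2 * M) r) = 0 := by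
  have hr2 : ∀ i, |r i| < ((2 * M : ℕ) : ℤ) := fun i => by
    have := hr i; push_cast; linarith [abs_nonneg (r i)]
  obtain ⟨hv, hv'⟩ := toTorus_twoMul_ne_dimerSite M i₀ hr
  exact autocorr_dimerPattern_of_ne M i₀ (fun h => hr0 (eq_zero_of_toTorus_eq_zero hr2 h)) hv hv'

/-- At the origin: `C₂(0) = M^{-d}` (`= (2M)^{-d} · 2 · 2^{d-1}`), equal to `C₁(0)`. -/
theorem autocorr_dimerPattern_zero (hd : 1 ≤ d) :
    autocorr (dimerPattern (d := d) M i₀) 0 = ((M : ℂ) ^ d)⁻¹ := by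
  rw [autocorr_zero, Finset.sum_eq_add (0 : TorusSite d (2 * M)) (dimerSite M i₀) (dimerSite_ne_zero M i₀).symm]
  · have hc : ‖(((Real.sqrt (2 ^ (d - 1)) : ℝ) : ℂ))‖ ^ 2 = 2 ^ (d - 1) := by
      rw [Complex.norm_real, Real.norm_eq_abs, abs_of_nonneg (Real.sqrt_nonneg _),
        Real.sq_sqrt (by positivity)]
    have h0 : dimerPattern (d := d) M i₀ 0 = ((Real.sqrt (2 ^ (d - 1)) : ℝ) : ℂ) := by simp [dimerPattern]
    have hv : dimerPattern (d := d) M i₀ (dimerSite M i₀) = -(((Real.sqrt (2 ^ (d - 1)) : ℝ) : ℂ)) := by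
      simp [dimerPattern, dimerSite_ne_zero M i₀]
    rw [h0, hv, norm_neg, hc]
    have h2 : ((2 : ℂ) ^ (d - 1) + 2 ^ (d - 1) : ℂ) = 2 ^ d := by
      obtain ⟨e, rfl⟩ : ∃ e, d = e + 1 := ⟨d - 1, by omega⟩
      simp [pow_succ]; ring
    push_cast
    rw [h2, mul_pow]
    have h2ne : ((2 : ℂ)) ^ d ≠ 0 := pow_ne_zero _ two_ne_zero
    have hMne : ((M : ℂ)) ^ d ≠ 0 := pow_ne_zero _ (Nat.cast_ne_zero.2 (NeZero.ne M))
    field_simp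
  · intro x _ hx
    rw [dimerPattern_of_ne M i₀ hx.1 hx.2]; simp
  · intro h; exact absurd (Finset.mem_univ _) h
  · intro h; exact absurd (Finset.mem_univ _) h

/-- **No ODLRO for the dimer pattern.** For EVERY finite measure `μ` representing `r ↦ C₂(r)`, the Bragg weight at
`Q = 0` is `0`. [cite: Yang1962, §3] -/
theorem braggWeight_zero_of_represents_dimerPattern (μ : Measure (EuclideanSpace ℝ (Fin d))) [IsFiniteMeasure μ]
    (hμ : ∀ r : Fin d → ℤ, ∫ ξ, exp ((∑ i, (r i : ℝ) * ξ i : ℝ) * I) ∂μ =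
      autocorr (dimerPattern (d := d) M i₀) (toTorus (2 * M) r)) :
    braggWeight μ ![(0 : Fin d → ℝ)] = 0 := by
  rw [← dualVec_zero (2 * M), braggWeight_of_represents_autocorr _ μ hμ 0, fourierCoeff_dimerPattern_zero,
    norm_zero, sq, mul_zero]

end Dimer

/-! ### §3. Sharpness of the `1/|B|` law; the barrier form -/

section Sharp

variable (M : ℕ) [NeZero M]

/-- **The two witnesses, packaged.** For every `M ≥ 1` and `d ≥ 1` there are finite measures `μ₁, μ₂` on `ℝᵈ`
representing lattice functions `C₁, C₂` (both autocorrelations of periodic patterns) that agree on the whole box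
`‖r‖∞ < M` (value `M^{-d}` at `0`, value `0` at `0 < ‖r‖∞ < M`) while `braggWeight μ₁ ![0] = C₁(0)/M^d > 0` and
`braggWeight μ₂ ![0] = 0`. [cite: Katznelson2004, I.7] -/
theorem exists_box_indistinguishable_ODLRO_witnesses (hd : 1 ≤ d) :
    ∃ (μ₁ μ₂ : Measure (EuclideanSpace ℝ (Fin d))) (_ : IsFiniteMeasure μ₁) (_ : IsFiniteMeasure μ₂)
      (C₁ C₂ : (Fin d → ℤ) → ℂ),
      (∀ r : Fin d → ℤ, ∫ ξ, exp ((∑ i, (r i : ℝ) * ξ i : ℝ) * I) ∂μ₁ = C₁ r) ∧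
      (∀ r : Fin d → ℤ, ∫ ξ, exp ((∑ i, (r i : ℝ) * ξ i : ℝ) * I) ∂μ₂ = C₂ r) ∧
      (∀ r : Fin d → ℤ, (∀ i, |r i| < M) → C₁ r = C₂ r) ∧
      C₁ 0 = ((M : ℂ) ^ d)⁻¹ ∧ C₂ 0 = ((M : ℂ) ^ d)⁻¹ ∧
      (∀ r : Fin d → ℤ, (∀ i, |r i| < M) → r ≠ 0 → C₁ r = 0 ∧ C₂ r = 0) ∧
      braggWeight μ₁ ![(0 : Fin d → ℝ)] = (((M : ℝ) ^ d)⁻¹) ^ 2 ∧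
      braggWeight μ₂ ![(0 : Fin d → ℝ)] = 0 := by
  obtain ⟨i₀⟩ : Nonempty (Fin d) := ⟨⟨0, hd⟩⟩
  refine ⟨atomicMeasure (patternVec d M) (patternWt (deltaPattern (d := d) M)),
    atomicMeasure (patternVec d (2 * M)) (patternWt (dimerPattern (d := d) M i₀)), inferInstance, inferInstance,
    fun r => autocorr (deltaPattern (d := d) M) (toTorus M r),
    fun r => autocorr (dimerPattern (d := d) M i₀) (toTorus (2 * M) r),
    atomicMeasure_represents_autocorr _, atomicMeasure_represents_autocorr _, ?_, ?_, ?_, ?_, ?_, ?_⟩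
  · intro r hr
    by_cases hr0 : r = 0
    · subst hr0
      have h1 : toTorus M (0 : Fin d → ℤ) = 0 := by funext i; simp [toTorus]
      have h2 : toTorus (2 * M) (0 : Fin d → ℤ) = 0 := by funext i; simp [toTorus]
      simp only [h1, h2]
      rw [autocorr_deltaPattern_zero, autocorr_dimerPattern_zero M i₀ hd]
    · simp only
      rw [autocorr_deltaPattern_toTorus_eq_zero M hr hr0, autocorr_dimerPattern_toTorus_eq_zero M i₀ hr hr0]
  · have h1 : toTorus M (0 : Fin d → ℤ) = 0 := by funext i; simp [toTorus]
    simp only [h1]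
    exact autocorr_deltaPattern_zero M
  · have h2 : toTorus (2 * M) (0 : Fin d → ℤ) = 0 := by funext i; simp [toTorus]
    simp only [h2]
    exact autocorr_dimerPattern_zero M i₀ hd
  · intro r hr hr0
    exact ⟨autocorr_deltaPattern_toTorus_eq_zero M hr hr0, autocorr_dimerPattern_toTorus_eq_zero M i₀ hr hr0⟩
  · exact braggWeight_zero_of_represents_deltaPattern M _ (atomicMeasure_represents_autocorr _)
  · exact braggWeight_zero_of_represents_dimerPattern M i₀ _ (atomicMeasure_represents_autocorr _)

/-- **BARRIER FORM (sharpness of the `1/|B|` law).** Let `Φ` assign to every lattice function `C : ℤᵈ → ℂ` a real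
number, SOUNDLY (`braggWeight μ ![0] ≤ Φ C` whenever a finite measure `μ` represents `C`) and RANGE-`M` LOCALLY
(`Φ C = Φ C'` whenever `C = C'` on `‖r‖∞ < M`). Then there is a represented lattice function `C` with NO off-diagonal
long-range order (`braggWeight μ ![0] = 0`), `C(0) = M^{-d} > 0`, on which `Φ` nevertheless reports at least
`C(0) · M^{-d}`: `(M^{-d})² ≤ Φ C`. Finite-range pair data plus positivity cannot certify an ODLRO density below
`P(0)/M^d`; the box functional `B = {0,…,M−1}ᵈ` attains this value. [cite: Katznelson2004, I.7] -/
theorem exists_noODLRO_witness_of_boxLocal_ceiling (hd : 1 ≤ d) (Φ : ((Fin d → ℤ) → ℂ) → ℝ)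
    (hsound : ∀ (μ : Measure (EuclideanSpace ℝ (Fin d))) [IsFiniteMeasure μ] (C : (Fin d → ℤ) → ℂ),
      (∀ r : Fin d → ℤ, ∫ ξ, exp ((∑ i, (r i : ℝ) * ξ i : ℝ) * I) ∂μ = C r) →
        braggWeight μ ![(0 : Fin d → ℝ)] ≤ Φ C)
    (hlocal : ∀ C C' : (Fin d → ℤ) → ℂ, (∀ r : Fin d → ℤ, (∀ i, |r i| < M) → C r = C' r) → Φ C = Φ C') :
    ∃ (μ : Measure (EuclideanSpace ℝ (Fin d))) (_ : IsFiniteMeasure μ) (C : (Fin d → ℤ) → ℂ),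
      (∀ r : Fin d → ℤ, ∫ ξ, exp ((∑ i, (r i : ℝ) * ξ i : ℝ) * I) ∂μ = C r) ∧
      braggWeight μ ![(0 : Fin d → ℝ)] = 0 ∧ C 0 = ((M : ℂ) ^ d)⁻¹ ∧
      (((M : ℝ) ^ d)⁻¹) ^ 2 ≤ Φ C := by
  obtain ⟨μ₁, μ₂, hf1, hf2, C₁, C₂, hμ₁, hμ₂, hagree, h10, h20, -, hb1, hb2⟩ :=
    exists_box_indistinguishable_ODLRO_witnesses (d := d) M hd
  refine ⟨μ₂, hf2, C₂, hμ₂, hb2, h20, ?_⟩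
  have h := hsound μ₁ C₁ hμ₁
  rw [hb1, hlocal C₁ C₂ hagree] at h
  exact h

end Sharp

end Summit.Ventures.CertifiedManyBodySolver.Observables

end
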